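import Summits.ABC.ABC.Theorems.IUTThetaPilotThetaPartIIOfChildren
import Summits.ABC.ABC.Theorems.IUTThetaPilotThetaPartIIStubHullVolumePerImage
import Summits.ABC.ABC.Theorems.IUTThetaPilotThetaPartIIDegLe
import Summits.ABC.ABC.Theorems.IUTThetaPilotGenEllTwo
import HarnessLib

/-!
# Route `IUTThetaPilot`: `ABC` from [IUTchIII] Cor. 3.12 at the Θ-data of the `λ`-line ALONE — every other link
# of the chain is a theorem of the tree (campaign-S shape of the route after `GenEllTwo` closed)

Mochizuki, *Inter-universal Teichmüller theory IV*, RIMS manuscript (Apr. 2020; = PRIMS **57** (2021)), Thm. 1.10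
(pp. 22–31), Cor. 2.2 (ii) (pp. 41–48), Cor. 2.3 (pp. 49–55); [GenEll] Thm. 2.1; [IUTchIII] Cor. 3.12 (kurims p. 174),
Step (x) (p. 181).

State of the route in the tree (2026-08-26): the support items `JInvWlog` (`JInvWlog_proof`) and `GenEllTwo`
(`genEllTwo_holds`, abc-iut-S6, stmt-ABC-19679 — [GenEll] Thm. 2.1 at `Σ = {2}`) are PROVED; the deciding theorem
`closes : ThetaPartII → GenEllTwo → JInvWlog → ABC` is certified; of the registered union skeleton of the crux
`ThetaPartII` (abc-iut-c312-8, sha16 76b99b29aaa7c8f6) the children (i) `ThetaPartII.stub_thetaData` (abc-iut-L5-t7)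
and (ii′-P) `ThetaPartII.stub_hullVolumePerImage` (abc-iut-c312-d1 over abc-iut-S3's pinned junction and abc-iut-S1's
(R4)) are THEOREMS. Hence, on the display-P line:

* **`ABC_of_cor312PerImage : stub_cor312PerImage → ABC`** — the abc conjecture from [IUTchIII] Cor. 3.12 (read per
  image, abc-iut-S7's `Cor22.Cor312PerImageAtDatum`) at every genuine Θ-volume datum of every admissible `(P, l)`,
  and NOTHING ELSE: exactly ONE `Prop` binder, the disputed claim itself;
* **`vojtaIneq_two_degLe_of_cor312PerImage`** — graded by degree and free of `GenEllTwo`: Cor. 3.12 per image at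
  the Θ-data of DEGREE `≤ d₀` alone ⟹ `VojtaIneq K_V d ε` for all `d ≤ d₀`, `ε > 0`, compactly bounded `K_V ∋ 2`
  (abc-iut-S2's «d-cut» chain `Thm110LegendreUpTo` ⟹ `PartIIUpTo` ⟹ Cor. 2.3); `…_degOne_…` is the rational-`λ` case;
* **`ABC_of_cor312_of_hullVolume : stub_cor312 → stub_hullVolume → ABC`** — the UNION line's shape (its volume
  child (ii′-U) is open off slot-constant data, plan VERDICT RISK ¶7; a theorem at `d_mod = 1`,
  `ThetaPartIIDisplay.hullVolumeAtDatum_BIII_of_degree_le_one`; d = 1 cut: `ThetaPartIIDisplay.vojtaIneq_two_degOne_of_cor312`).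

All CONDITIONAL (`proof.conditional`) on the named Cor. 3.12 hypothesis; the crux item stmt-ABC-19678 stays OPEN;
nothing here asserts abc, Thm. 1.10 or Cor. 3.12 (CLAIM form, DISPUTED in print — Scholze–Stix 2018), and no side is
taken on the dispute or on the (U)/(P) reading question (ref-b).
-/

set_option linter.dupNamespace false

noncomputable section

namespace Summit.ABC.ABC.Theorems

open Literature.NumberTheory.DiophantineGeometry.GenEll Literature.IUT.LogVolume

/-- **`ABC` from [IUTchIII] Cor. 3.12 (per-image reading) at the Θ-data of the `λ`-line ALONE** (display-P line of
the crux `ThetaPartII`): children (i) `ThetaPartII.stub_thetaData`, (ii′-P) `ThetaPartII.stub_hullVolumePerImage`,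
the supports `genEllTwo_holds`, `JInvWlog_proof` and the deciding theorem `closes` are theorems of the tree, so the
ONLY hypothesis is (iii-P) `stub_cor312PerImage` — the disputed claim itself, stated verbatim as registered.
CONDITIONAL on exactly that; nothing asserted; no side taken.
[cite: Mochizuki2012, IUTchIV Thm. 1.10, Cor. 2.2 (ii), Cor. 2.3 pp.22–55] [claim: Mochizuki2012, status: disputed] -/
theorem ABC_of_cor312PerImage
    (h312 : ∀ P : NFPoint, P ∈ UP → ∀ l : ℕ, l.Prime → 5 ≤ l →
      Cor22.AdmitsCore P → Cor22.CondP2 P l → Cor22.CondP5 P l → Cor22.CondP6 P l →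
        Cor22.Cor312PerImageAtDatum P l) : _root_.ABC :=
  ABC_of_cor312PerImage_of_hullVolumePerImage_of_genEllTwo h312 ThetaPartII.stub_hullVolumePerImage
    genEllTwo_holds

/-- **Uniform Vojta / abc over all number fields of degree `≤ d₀` from [IUTchIII] Cor. 3.12 (per-image reading) at
the Θ-data of the `λ`-line of DEGREE `≤ d₀` ALONE**: for every `d ≤ d₀`, every `ε > 0` and every compactly bounded
`K_V ∋ 2`, `VojtaIneq K_V d ε` — the volume child (ii′-P) is a theorem at every degree
(`ThetaPartII.stub_hullVolumePerImage`); the chain is `ThetaPartIIDisplay.vojtaIneq_two_degLe_of_cor312PerImage_of_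
hullVolumePerImage` (Thm. 1.10 up to `d₀` ⟹ Cor. 2.2 (ii) up to `d₀` ⟹ Cor. 2.3 at each `d ≤ d₀`). No `GenEllTwo`
(it enters only to trade `K_V ∋ 2` for a general `K_V`). CONDITIONAL; nothing asserted; no side taken.
[cite: Mochizuki2012, IUTchIV Cor. 2.2 (ii)–2.3 pp.41–55] [claim: Mochizuki2012, status: disputed] -/
theorem vojtaIneq_two_degLe_of_cor312PerImage {d₀ : ℕ}
    (h312 : ∀ P : NFPoint, P ∈ UP → P.degree ≤ d₀ → ∀ l : ℕ, l.Prime → 5 ≤ l →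
      Cor22.AdmitsCore P → Cor22.CondP2 P l → Cor22.CondP5 P l → Cor22.CondP6 P l →
        Cor22.Cor312PerImageAtDatum P l) :
    ∀ d : ℕ, 0 < d → d ≤ d₀ → ∀ ε : ℝ, 0 < ε → ∀ D : CBData, D.SupportContains {2} →
      VojtaIneq D.toSet d ε :=
  ThetaPartIIDisplay.vojtaIneq_two_degLe_of_cor312PerImage_of_hullVolumePerImage h312
    fun P hP _ l hl h5 hcore hP2 hP5 h6 => ThetaPartII.stub_hullVolumePerImage P hP l hl h5 hcore hP2 hP5 h6

/-- **abc for `d = 1` from [IUTchIII] Cor. 3.12 (per-image reading) at the Θ-data of RATIONAL `λ` ALONE**: for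
every `ε > 0` and every compactly bounded `K_V ∋ 2`, `VojtaIneq K_V 1 ε` (the degree-1 instances of
`stub_cor312PerImage` suffice; cf. the union-line twin `ThetaPartIIDisplay.vojtaIneq_two_degOne_of_cor312`, where
`d_mod = 1` makes the two readings coincide). CONDITIONAL; nothing asserted; no side taken.
[cite: Mochizuki2012, IUTchIV Cor. 2.2 (ii)–2.3 pp.41–55] [claim: Mochizuki2012, status: disputed] -/
theorem vojtaIneq_two_degOne_of_cor312PerImage
    (h312 : ∀ P : NFPoint, P ∈ UP → P.degree ≤ 1 → ∀ l : ℕ, l.Prime → 5 ≤ l →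
      Cor22.AdmitsCore P → Cor22.CondP2 P l → Cor22.CondP5 P l → Cor22.CondP6 P l →
        Cor22.Cor312PerImageAtDatum P l)
    {ε : ℝ} (hε : 0 < ε) (D : CBData) (hD : D.SupportContains {2}) : VojtaIneq D.toSet 1 ε :=
  vojtaIneq_two_degLe_of_cor312PerImage h312 1 one_pos le_rfl ε hε D hD

/-- **`ABC` from [IUTchIII] Cor. 3.12 (UNION reading, `stub_cor312`) and the union-hull log-volume estimate (ii′-U)
(`stub_hullVolume`, computable, OPEN off slot-constant data — plan VERDICT RISK ¶7; a theorem at `d_mod = 1`)** —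
the union line's shape with `GenEllTwo` discharged (`genEllTwo_holds`). CONDITIONAL; nothing asserted; no side
taken on the dispute or on the (U)/(P) reading. [cite: Mochizuki2012, IUTchIV Thm. 1.10, Cor. 2.2 (ii), Cor. 2.3 pp.22–55]
[claim: Mochizuki2012, status: disputed] -/
theorem ABC_of_cor312_of_hullVolume
    (h312 : ∀ P : NFPoint, P ∈ UP → ∀ l : ℕ, l.Prime → 5 ≤ l →
      Cor22.AdmitsCore P → Cor22.CondP2 P l → Cor22.CondP5 P l → Cor22.CondP6 P l → Cor22.Cor312AtDatum P l)
    (hvol : ∀ P : NFPoint, P ∈ UP → ∀ l : ℕ, l.Prime → 5 ≤ l →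
      Cor22.AdmitsCore P → Cor22.CondP2 P l → Cor22.CondP5 P l → Cor22.CondP6 P l →
        Cor22.HullVolumeAtDatum P l (((l : ℝ) + 1) / 4 *
          ((1 + 12 * (Cor22.dmod P : ℝ) / l) * (P.logDiff + Cor22.logCondAvoid P {2, l})
            + 2 * Real.log l + 52
            + 20 / 3 * Real.log (((2 ^ 12 * 3 ^ 3 * 5 * Cor22.dmod P : ℕ) : ℝ) * (l : ℝ))
              * (Nat.primeCounting (2 ^ 12 * 3 ^ 3 * 5 * Cor22.dmod P * l) : ℝ)))) : _root_.ABC :=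
  ABC_of_cor312_of_hullVolume_of_genEllTwo h312 hvol genEllTwo_holds

end Summit.ABC.ABC.Theorems

end
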